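import Summits.KontsevichZagierPeriods.KontsevichZagierPeriods.Theses.GenericPointClass
import Summits.KontsevichZagierPeriods.KontsevichZagierPeriods.Theorems.GaussManinCertificatesKZStokesBox
import Summits.KontsevichZagierPeriods.KontsevichZagierPeriods.Theorems.UnfoldedStokesStokesGenerationStubBoxToCube
import Literature.NumberTheory.Transcendental.KZLogCalculusProofs
import Literature.NumberTheory.Transcendental.KZUnfoldedStokesProofs
import Literature.NumberTheory.Transcendental.KZGroundingRelations

/-!
# `ExactDescentBox` (stmt-KontsevichZagierPeriods-4427, route GenericPointClass) — complete candidate proof, SELF-CONTAINED variant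

THEOREM B ON BOXES (the engine of route GenericPointClass): on an open box `∏ (aᵢ, bᵢ) ⊂ ℝⁿ⁺¹`, an
integrand which is an explicit divergence `∑ᵢ ∂ᵢAᵢ` of `ℚ`-semialgebraic potentials continuous on
the closed box descends, inside `KZ.relations`, to the sum of the `n + 1` face representations
`[face boxᵢ, Aᵢ(xᵢ = bᵢ) − Aᵢ(xᵢ = aᵢ)]`.

Proof = strategist line `affine_cube` (Cruxes/ExactDescentBox/Lines/affine_cube.lean) with ALL THREE
stubs closed:
* §1 `OpenBoxToCube` — affine cubification of an open box with algebraic corners is one rule-(2)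
  move (open twin of the landed `StokesGeneration.FibrewiseStokes.stub_boxToCube`; proved here);
* the cube engine `CubeCoordinateCycle` / `CubeLastNewtonLeibniz` — items stmt-17772 / stmt-17771 of
  route CobordismMove, proved in `CubeStokesProof.lean` §2–§3 — INLINED here verbatim as §0a/§0b so that the file
  depends on landed modules only (if `Theorems/CobordismMoveCubeStokes.lean` lands first, delete §0 and use its names);
* §2–§5 the glue: coordinate cycles on the unit cube, honest face representations, descent along one
  coordinate on the cube, the diagonal affine chart, descent along one coordinate on a box;
* §6 the assembly `exactDescentBox_proof : ExactDescentBox` (finite-sum bookkeeping by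
  `KZ.of_sub_sum_integrand_mem_relations`; no conditional declaration is left in the file).

`lean check`: rc 0, 0 sorry, axioms propext / Classical.choice / Quot.sound (strategist seat
planner-cstrat-stmt-KontsevichZagierPeriods-4427-s2-0, 2026-08-17). PROVER LANDING: this file is
> 400 lines — land §1–§2 + §4 (helpers, namespace `…GenericPointClass.ExactDescentBox`) as
`Theorems/GenericPointClassExactDescentBoxAux.lean` and §3, §5, §6 as
`Theorems/GenericPointClassExactDescentBox.lean` importing it; close stmt-4427
`--by Summit.KontsevichZagierPeriods.GenericPointClass.exactDescentBox_proof`.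

References: M. Kontsevich, D. Zagier, *Periods* (2001), §1.2, rules (1)–(3); A. Huber,
S. Müller-Stach, *Periods and Nori Motives* (2017), §13.1; J. Bochnak, M. Coste, M.-F. Roy,
*Real Algebraic Geometry* (1998), §2.2.
-/

noncomputable section

open MeasureTheory Set
open Literature.NumberTheory.Transcendental
open Literature.NumberTheory.Transcendental.KZ (IntegralRep of relations changeOfVariablesRel_subset_relations)
open Literature.ModelTheory.ExponentialFields (IsSemialgebraic)
open Summit.KontsevichZagierPeriods.GaussManinCertificates
  (isAlgebraic_corner_of_isSemialgebraic_openBox isSemialgebraic_openBox_of_isAlgebraic)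
open Summit.KontsevichZagierPeriods.KontsevichZagierPeriods.Cruxes.StokesGeneration.FibrewiseStokes
  (boxAff_isSemialgebraicMapOn boxAff_isAlgebraic_prod boxAff_injective boxAff_diag_det boxAff_hasFDerivAt)

namespace Summit.KontsevichZagierPeriods.GenericPointClass.ExactDescentBox

open MvPolynomial (X)

/-! ### §0a The cube engine, piece `CubeCoordinateCycle` (item stmt-17772; VERBATIM copy of Cruxes/CubeStokes/CubeStokesProof.lean §2, strategist cstrat-5566) -/

namespace CubeCoordinateCycle

variable {d : ℕ}

/-- The coordinate cycle `z ↦ Fin.insertNth k (z last) (Fin.init z)` of `ℝ^(d+1)` is the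
relabelling of coordinates along the index permutation
`(finSuccEquiv' k).trans (finSuccEquiv' (Fin.last d)).symm` (`k ↦ last`, `k.succAbove j ↦ j.castSucc`).
[folklore] -/
theorem exists_perm_insertNth (k : Fin (d + 1)) :
    ∃ e : Equiv.Perm (Fin (d + 1)), ∀ z : Fin (d + 1) → ℝ,
      (fun i => z (e i)) = (Fin.insertNth k (z (Fin.last d)) (Fin.init z) : Fin (d + 1) → ℝ) := by
  refine ⟨(finSuccEquiv' k).trans (finSuccEquiv' (Fin.last d)).symm, fun z => ?_⟩
  funext i
  rcases Fin.eq_self_or_eq_succAbove k i with rfl | ⟨j, rfl⟩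
  · simp [finSuccEquiv'_at, finSuccEquiv'_symm_none, Fin.insertNth_apply_same]
  · simp [finSuccEquiv'_succAbove, finSuccEquiv'_symm_some, Fin.insertNth_apply_succAbove,
      Fin.succAbove_last, Fin.init]

/-- The open unit cube is invariant under relabelling coordinates. [folklore] -/
theorem comp_perm_mem_setOf_iff {n : ℕ} (e : Equiv.Perm (Fin n)) (z : Fin n → ℝ) :
    (fun i => z (e i)) ∈ {x : Fin n → ℝ | ∀ i, x i ∈ Ioo (0 : ℝ) 1} ↔
      z ∈ {x : Fin n → ℝ | ∀ i, x i ∈ Ioo (0 : ℝ) 1} := by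
  simp only [mem_setOf_eq]
  exact ⟨fun h i => by simpa using h (e.symm i), fun h i => h (e i)⟩

/-- The open unit cube has Lebesgue measure `1`. [folklore] -/
theorem volume_setOf_cube (n : ℕ) :
    volume {x : Fin n → ℝ | ∀ i, x i ∈ Ioo (0 : ℝ) 1} = 1 := by
  rw [show {x : Fin n → ℝ | ∀ i, x i ∈ Ioo (0 : ℝ) 1} = Set.pi univ fun _ => Ioo (0 : ℝ) 1 from
    KZ.unitCube_eq_pi n, Real.volume_pi_Ioo]
  simp

/-- **`CubeCoordinateCycle`** (stmt-KontsevichZagierPeriods-17772): cycling a coordinate of the open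
unit cube to the last slot is a move, for an arbitrary integrand. The statement is the literal body
of the route item. [cite: KontsevichZagier2001, §1.2 rule (2)] -/
theorem cubeCoordinateCycle_proof :
    ∀ (d : ℕ) (k : Fin (d + 1)) (R R' : Literature.NumberTheory.Transcendental.KZ.IntegralRep (d + 1)),
      R.domain = {x : Fin (d + 1) → ℝ | ∀ i, x i ∈ Set.Ioo (0 : ℝ) 1} →
      R'.domain = {x : Fin (d + 1) → ℝ | ∀ i, x i ∈ Set.Ioo (0 : ℝ) 1} →
      Set.EqOn R'.integrand (fun z => R.integrand (Fin.insertNth k (z (Fin.last d)) (Fin.init z))) R'.domain →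
      Literature.NumberTheory.Transcendental.KZ.of R - Literature.NumberTheory.Transcendental.KZ.of R' ∈
        Literature.NumberTheory.Transcendental.KZ.relations := by
  intro d k R R' hRd hR'd hR'i
  obtain ⟨e, he⟩ := exists_perm_insertNth (d := d) k
  -- the relabelling as a continuous linear map
  set L : (Fin (d + 1) → ℝ) →L[ℝ] (Fin (d + 1) → ℝ) :=
    LinearMap.toContinuousLinearMap (LinearMap.funLeft ℝ ℝ e) with hL
  have hLapply : ∀ x : Fin (d + 1) → ℝ, L x = fun i => x (e i) := fun x => by
    rw [hL, LinearMap.coe_toContinuousLinearMap']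
    rfl
  -- `L` maps the cube onto itself, injectively
  have himage : L '' R'.domain = R.domain := by
    rw [hRd, hR'd]
    ext y
    constructor
    · rintro ⟨x, hx, rfl⟩
      rw [hLapply]
      exact (comp_perm_mem_setOf_iff e x).2 hx
    · intro hy
      refine ⟨fun i => y (e.symm i), ?_, ?_⟩
      · have h := (comp_perm_mem_setOf_iff e.symm y).2 hy
        exact h
      · rw [hLapply]
        funext i
        simp
  have hLinj : InjOn L R'.domain := by
    intro x _ y _ hxy
    rw [hLapply, hLapply] at hxy
    funext j
    have h := congr_fun hxy (e.symm j)
    simpa using h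
  -- `L` is a `ℚ`-polynomial (coordinate) map, hence semialgebraic
  have hLsa : IsSemialgebraicMapOn ℚ R'.domain L := by
    refine (isSemialgebraicMapOn_aeval R'.isSemialgebraic_domain fun j => X (e j)).congr fun x _ => ?_
    rw [hLapply]
    ext j
    simp
  -- `|det L| = 1` by volume preservation of the cube
  have hdet : |L.det| = 1 := by
    have h := Measure.addHaar_image_continuousLinearMap volume L R'.domain
    rw [himage, hRd, volume_setOf_cube, hR'd, volume_setOf_cube, mul_one] at h
    exact ENNReal.ofReal_eq_one.1 h.symm
  -- one change-of-variables move from `R'` to `R`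
  have hcov : KZ.of R' - KZ.of R ∈ KZ.changeOfVariablesRel := by
    refine ⟨d + 1, R', R, L, fun _ => L, hLsa, fun _ _ => L.hasFDerivWithinAt, hLinj, himage.symm,
      fun x hx => ?_, rfl⟩
    rw [hR'i hx, hdet, mul_one, hLapply, he x]
  have h := KZ.changeOfVariablesRel_subset_relations hcov
  have hneg : KZ.of R - KZ.of R' = -(KZ.of R' - KZ.of R) := by abel
  rw [hneg]
  exact KZ.relations.neg_mem h

end CubeCoordinateCycle

/-! ### §0b The cube engine, piece `CubeLastNewtonLeibniz` (item stmt-17771; VERBATIM copy of CubeStokesProof.lean §3) -/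

namespace CubeLastNewtonLeibniz

variable {d : ℕ}

/-! ### The open cubes, the band and its faces -/

/-- `t ↦ Fin.snoc x t` is continuous. [folklore] -/
theorem continuous_snoc (x : Fin d → ℝ) :
    Continuous (fun t : ℝ => (Fin.snoc x t : Fin (d + 1) → ℝ)) := by
  refine continuous_pi fun i => ?_
  refine Fin.lastCases ?_ (fun j => ?_) i
  · simp only [Fin.snoc_last]
    exact continuous_id
  · simp only [Fin.snoc_castSucc]
    exact continuous_const

/-- A point of the open `d`-cube with a last coordinate in `(0,1)` is a point of the open
`(d+1)`-cube. [folklore] -/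
theorem snoc_mem_setOf {x : Fin d → ℝ} (hx : x ∈ {y : Fin d → ℝ | ∀ i, y i ∈ Ioo (0 : ℝ) 1})
    {t : ℝ} (ht : t ∈ Ioo (0 : ℝ) 1) :
    (Fin.snoc x t : Fin (d + 1) → ℝ) ∈ {z : Fin (d + 1) → ℝ | ∀ i, z i ∈ Ioo (0 : ℝ) 1} := by
  simp only [mem_setOf_eq] at hx ⊢
  intro i
  refine Fin.lastCases ?_ (fun j => ?_) i
  · simpa [Fin.snoc_last] using ht
  · simpa [Fin.snoc_castSucc] using hx j

/-- A point of the open `d`-cube with a last coordinate in `[0,1]` is a point of the closed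
`(d+1)`-cube. [folklore] -/
theorem snoc_mem_Icc {x : Fin d → ℝ} (hx : x ∈ {y : Fin d → ℝ | ∀ i, y i ∈ Ioo (0 : ℝ) 1})
    {t : ℝ} (ht : t ∈ Icc (0 : ℝ) 1) :
    (Fin.snoc x t : Fin (d + 1) → ℝ) ∈ Icc (0 : Fin (d + 1) → ℝ) 1 := by
  simp only [mem_setOf_eq] at hx
  rw [mem_Icc, Pi.le_def, Pi.le_def]
  constructor
  · intro i
    refine Fin.lastCases ?_ (fun j => ?_) i
    · simpa [Fin.snoc_last] using ht.1
    · simpa [Fin.snoc_castSucc] using (hx j).1.le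
  · intro i
    refine Fin.lastCases ?_ (fun j => ?_) i
    · simpa [Fin.snoc_last] using ht.2
    · simpa [Fin.snoc_castSucc] using (hx j).2.le

/-- The open `(d+1)`-cube lies in the closed-fibre band over the open `d`-cube. [folklore] -/
theorem setOf_subset_band :
    {z : Fin (d + 1) → ℝ | ∀ i, z i ∈ Ioo (0 : ℝ) 1} ⊆
      KZlog.band {y : Fin d → ℝ | ∀ i, y i ∈ Ioo (0 : ℝ) 1} (fun _ => 0) (fun _ => 1) := by
  intro z hz
  simp only [mem_setOf_eq] at hz
  refine ⟨fun j => hz (Fin.castSucc j), (hz (Fin.last d)).1.le, (hz (Fin.last d)).2.le⟩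

/-- The closed-fibre band over the open `d`-cube lies in the closed `(d+1)`-cube. [folklore] -/
theorem band_subset_Icc :
    KZlog.band {y : Fin d → ℝ | ∀ i, y i ∈ Ioo (0 : ℝ) 1} (fun _ => 0) (fun _ => 1) ⊆
      Icc (0 : Fin (d + 1) → ℝ) 1 := by
  intro z hz
  rw [KZlog.mem_band, mem_setOf_eq] at hz
  obtain ⟨hinit, h0, h1⟩ := hz
  rw [mem_Icc, Pi.le_def, Pi.le_def]
  constructor
  · intro i
    refine Fin.lastCases ?_ (fun j => ?_) i
    · simpa using h0
    · simpa [Fin.init] using (hinit j).1.le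
  · intro i
    refine Fin.lastCases ?_ (fun j => ?_) i
    · simpa using h1
    · simpa [Fin.init] using (hinit j).2.le

/-- The band minus the open cube lies in the two faces `{z last = 0} ∪ {z last = 1}`.
[folklore] -/
theorem band_diff_subset :
    KZlog.band {y : Fin d → ℝ | ∀ i, y i ∈ Ioo (0 : ℝ) 1} (fun _ => 0) (fun _ => 1) \
        {z : Fin (d + 1) → ℝ | ∀ i, z i ∈ Ioo (0 : ℝ) 1} ⊆
      {z : Fin (d + 1) → ℝ | z (Fin.last d) = 0} ∪ {z : Fin (d + 1) → ℝ | z (Fin.last d) = 1} := by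
  rintro z ⟨hzB, hzU⟩
  rw [KZlog.mem_band, mem_setOf_eq] at hzB
  obtain ⟨hinit, h0, h1⟩ := hzB
  simp only [mem_setOf_eq, not_forall] at hzU
  obtain ⟨i, hi⟩ := hzU
  simp only [mem_union, mem_setOf_eq]
  by_contra hcon
  push Not at hcon
  apply hi
  refine Fin.lastCases ?_ (fun j => ?_) i
  · exact ⟨lt_of_le_of_ne h0 (Ne.symm hcon.1), lt_of_le_of_ne h1 hcon.2⟩
  · exact hinit j

/-! ### The proof -/

/-- **`CubeLastNewtonLeibniz`** (stmt-KontsevichZagierPeriods-17771): Newton–Leibniz along the last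
coordinate of the open unit cube, bulk term included — `[R] − [r₁] + [r₀] ∈ KZ.relations`. The
statement is the literal body of the route item. [cite: KontsevichZagier2001, §1.2 rule (3)] -/
theorem cubeLastNewtonLeibniz_proof :
    ∀ (d : ℕ) (A A' : (Fin (d + 1) → ℝ) → ℝ) (R : Literature.NumberTheory.Transcendental.KZ.IntegralRep (d + 1))
      (r₀ r₁ : Literature.NumberTheory.Transcendental.KZ.IntegralRep d),
      Literature.NumberTheory.Transcendental.IsSemialgebraicFunOn ℚ (Set.Icc (0 : Fin (d + 1) → ℝ) 1) A →
      ContinuousOn A (Set.Icc (0 : Fin (d + 1) → ℝ) 1) →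
      (∀ y ∈ {y : Fin d → ℝ | ∀ i, y i ∈ Set.Ioo (0 : ℝ) 1}, ∀ t ∈ Set.Ioo (0 : ℝ) 1,
        HasDerivAt (fun s : ℝ => A (Fin.snoc y s)) (A' (Fin.snoc y t)) t) →
      R.domain = {x : Fin (d + 1) → ℝ | ∀ i, x i ∈ Set.Ioo (0 : ℝ) 1} →
      Set.EqOn R.integrand A' R.domain →
      r₀.domain = {y : Fin d → ℝ | ∀ i, y i ∈ Set.Ioo (0 : ℝ) 1} →
      r₁.domain = {y : Fin d → ℝ | ∀ i, y i ∈ Set.Ioo (0 : ℝ) 1} →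
      Set.EqOn r₀.integrand (fun y => A (Fin.snoc y 0)) r₀.domain →
      Set.EqOn r₁.integrand (fun y => A (Fin.snoc y 1)) r₁.domain →
      Literature.NumberTheory.Transcendental.KZ.of R - Literature.NumberTheory.Transcendental.KZ.of r₁ +
        Literature.NumberTheory.Transcendental.KZ.of r₀ ∈ Literature.NumberTheory.Transcendental.KZ.relations := by
  intro d A A' R r₀ r₁ hA hcont hder hRd hRi hr₀d hr₁d hface₀ hface₁
  -- the cubes and the band
  have hUd : IsSemialgebraic ℚ {y : Fin d → ℝ | ∀ i, y i ∈ Ioo (0 : ℝ) 1} := KZ.isSemialgebraic_unitCube d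
  have hU : IsSemialgebraic ℚ {x : Fin (d + 1) → ℝ | ∀ i, x i ∈ Ioo (0 : ℝ) 1} :=
    KZ.isSemialgebraic_unitCube (d + 1)
  have hUdm : MeasurableSet {y : Fin d → ℝ | ∀ i, y i ∈ Ioo (0 : ℝ) 1} :=
    (KZ.isOpen_unitCube d).measurableSet
  have hUm : MeasurableSet R.domain := KZ.IntegralRep.measurableSet_domain_holds R
  have hB : IsSemialgebraic ℚ
      (KZlog.band {y : Fin d → ℝ | ∀ i, y i ∈ Ioo (0 : ℝ) 1} (fun _ => 0) (fun _ => 1)) :=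
    KZlog.isSemialgebraic_band (by simpa using isSemialgebraicFunOn_ratCast hUd 0)
      (by simpa using isSemialgebraicFunOn_ratCast hUd 1)
  have hT : IsSemialgebraic ℚ
      (KZlog.band {y : Fin d → ℝ | ∀ i, y i ∈ Ioo (0 : ℝ) 1} (fun _ => 0) (fun _ => 1) \ R.domain) := by
    rw [Set.sdiff_eq]
    exact hB.inter (hRd ▸ hU).compl
  have hUB : R.domain ⊆ KZlog.band {y : Fin d → ℝ | ∀ i, y i ∈ Ioo (0 : ℝ) 1} (fun _ => 0) (fun _ => 1) := by
    rw [hRd]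
    exact setOf_subset_band
  -- (1a) the integrand of `R` extended by zero, an honest representation on the band
  have hgsa : IsSemialgebraicFunOn ℚ
      (KZlog.band {y : Fin d → ℝ | ∀ i, y i ∈ Ioo (0 : ℝ) 1} (fun _ => 0) (fun _ => 1))
      (R.domain.indicator R.integrand) := by
    have h := IsSemialgebraicFunOn.union R.isSemialgebraicFunOn_integrand
      (isSemialgebraicFunOn_ratCast hT 0) (F := R.domain.indicator R.integrand)
      (fun x hx => Set.indicator_of_mem hx _) (fun x hx => by
        rw [Set.indicator_of_notMem hx.2]
        simp)
    rwa [Set.union_sdiff_cancel hUB] at h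
  have hgint : IntegrableOn (R.domain.indicator R.integrand)
      (KZlog.band {y : Fin d → ℝ | ∀ i, y i ∈ Ioo (0 : ℝ) 1} (fun _ => 0) (fun _ => 1)) :=
    ((integrable_indicator_iff hUm).2 R.integrableOn).integrableOn
  have hRbex : ∃ Rb : KZ.IntegralRep (d + 1),
      Rb.domain = KZlog.band {y : Fin d → ℝ | ∀ i, y i ∈ Ioo (0 : ℝ) 1} (fun _ => 0) (fun _ => 1) ∧
        Rb.integrand = R.domain.indicator R.integrand :=
    ⟨⟨_, _, hB, hgsa, hgint⟩, rfl, rfl⟩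
  obtain ⟨Rb, hRbd, hRbi⟩ := hRbex
  have hNtex : ∃ Nt : KZ.IntegralRep (d + 1),
      Nt.domain = KZlog.band {y : Fin d → ℝ | ∀ i, y i ∈ Ioo (0 : ℝ) 1} (fun _ => 0) (fun _ => 1) \ R.domain ∧
        Nt.integrand = R.domain.indicator R.integrand :=
    ⟨⟨_, _, hT, hgsa.mono Set.sdiff_subset hT, hgint.mono_set Set.sdiff_subset⟩, rfl, rfl⟩
  obtain ⟨Nt, hNtd, hNti⟩ := hNtex
  have h1a : KZ.of Rb - KZ.of R - KZ.of Nt ∈ KZ.relations := by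
    refine KZ.domainAddRel_subset_relations ⟨d + 1, Rb, R, Nt, ?_, ?_, ?_, ?_, rfl⟩
    · rw [hRbd, hNtd, Set.union_sdiff_cancel hUB]
    · rw [hNtd, Set.inter_sdiff_self, measure_empty]
    · intro x hx
      rw [hRbi, Set.indicator_of_mem hx]
    · intro x _
      rw [hRbi, hNti]
  have hNt : KZ.of Nt ∈ KZ.relations := by
    refine KZ.of_mem_relations_of_volume_eq_zero Nt ?_
    rw [hNtd]
    refine measure_mono_null ?_
      (measure_union_null (KZ.volume_setOf_last_eq_zero (n := d) 0) (KZ.volume_setOf_last_eq_zero (n := d) 1))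
    rw [hRd]
    exact band_diff_subset
  -- (3) the base representation `[(0,1)^d, A(·,1) − A(·,0)]` and the Newton–Leibniz instance
  have hA1sa : IsSemialgebraicFunOn ℚ {y : Fin d → ℝ | ∀ i, y i ∈ Ioo (0 : ℝ) 1}
      (fun y => A (Fin.snoc y 1)) := by
    have h := r₁.isSemialgebraicFunOn_integrand
    rw [hr₁d] at h
    exact h.congr fun y hy => hface₁ (by rw [hr₁d]; exact hy)
  have hA0sa : IsSemialgebraicFunOn ℚ {y : Fin d → ℝ | ∀ i, y i ∈ Ioo (0 : ℝ) 1}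
      (fun y => A (Fin.snoc y 0)) := by
    have h := r₀.isSemialgebraicFunOn_integrand
    rw [hr₀d] at h
    exact h.congr fun y hy => hface₀ (by rw [hr₀d]; exact hy)
  have hDsa : IsSemialgebraicFunOn ℚ {y : Fin d → ℝ | ∀ i, y i ∈ Ioo (0 : ℝ) 1}
      (fun y => A (Fin.snoc y 1) - A (Fin.snoc y 0)) :=
    (IsSemialgebraicFunOn.sub_holds hA1sa hA0sa).congr fun _ _ => rfl
  have hA1int : IntegrableOn (fun y => A (Fin.snoc y 1)) {y : Fin d → ℝ | ∀ i, y i ∈ Ioo (0 : ℝ) 1} := by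
    have h := r₁.integrableOn
    rw [hr₁d] at h
    exact h.congr_fun (fun y hy => hface₁ (by rw [hr₁d]; exact hy)) hUdm
  have hA0int : IntegrableOn (fun y => A (Fin.snoc y 0)) {y : Fin d → ℝ | ∀ i, y i ∈ Ioo (0 : ℝ) 1} := by
    have h := r₀.integrableOn
    rw [hr₀d] at h
    exact h.congr_fun (fun y hy => hface₀ (by rw [hr₀d]; exact hy)) hUdm
  have hrDex : ∃ rD : KZ.IntegralRep d, rD.domain = {y : Fin d → ℝ | ∀ i, y i ∈ Ioo (0 : ℝ) 1} ∧
      rD.integrand = fun y => A (Fin.snoc y 1) - A (Fin.snoc y 0) :=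
    ⟨⟨_, _, hUd, hDsa, hA1int.sub hA0int⟩, rfl, rfl⟩
  obtain ⟨rD, hrDd, hrDi⟩ := hrDex
  have h3 : KZ.of Rb - KZ.of rD ∈ KZ.relations := by
    refine KZ.newtonLeibnizRel_subset_relations ⟨d, Rb, rD, fun _ => 0, fun _ => 1, A, ?_, ?_, ?_,
      fun _ _ => zero_le_one, ?_, ?_, ?_, ?_, rfl⟩
    · rw [hRbd]
      exact hA.mono band_subset_Icc hB
    · simpa using isSemialgebraicFunOn_ratCast rD.isSemialgebraic_domain 0
    · simpa using isSemialgebraicFunOn_ratCast rD.isSemialgebraic_domain 1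
    · rw [hRbd, hrDd]
      rfl
    · intro x hx
      rw [hrDd] at hx
      exact hcont.comp (continuous_snoc x).continuousOn fun t ht => snoc_mem_Icc hx ht
    · intro x hx t ht
      rw [hrDd] at hx
      have hmem : (Fin.snoc x t : Fin (d + 1) → ℝ) ∈ R.domain := by
        rw [hRd]
        exact snoc_mem_setOf hx ht
      refine (hder x hx t ht).congr_deriv ?_
      rw [hRbi, Set.indicator_of_mem hmem]
      exact (hRi hmem).symm
    · intro x _
      rw [hrDi]
  -- (1b) split the base representation into the two faces
  have h1b : KZ.of rD - KZ.of r₁ - KZ.of r₀.neg ∈ KZ.relations := by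
    refine KZ.integrandAddRel_subset_relations ⟨d, rD, r₁, r₀.neg, by rw [hr₁d, hrDd],
      by rw [KZ.IntegralRep.domain_neg, hr₀d, hrDd], fun y hy => ?_, rfl⟩
    rw [hrDd] at hy
    rw [hrDi, Pi.add_apply, KZ.IntegralRep.integrand_neg, Pi.neg_apply,
      hface₁ (by rw [hr₁d]; exact hy), hface₀ (by rw [hr₀d]; exact hy)]
    ring
  have hneg : KZ.of r₀.neg + KZ.of r₀ ∈ KZ.relations := by
    have h := KZ.of_add_of_mem_relations_of_eqOn_neg (r := r₀) (r' := r₀.neg)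
      (KZ.IntegralRep.domain_neg r₀) (fun x _ => by rw [KZ.IntegralRep.integrand_neg])
    rwa [add_comm] at h
  -- collect
  have key : KZ.of R - KZ.of r₁ + KZ.of r₀ =
      -(KZ.of Rb - KZ.of R - KZ.of Nt) - KZ.of Nt + (KZ.of Rb - KZ.of rD) +
        (KZ.of rD - KZ.of r₁ - KZ.of r₀.neg) + (KZ.of r₀.neg + KZ.of r₀) := by
    abel
  rw [key]
  exact KZ.relations.add_mem (KZ.relations.add_mem (KZ.relations.add_mem (KZ.relations.sub_mem
    (KZ.relations.neg_mem h1a) hNt) h3) h1b) hneg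

end CubeLastNewtonLeibniz

/-! ### The three statements of line `affine_cube` -/

/-- **Affine cubification of an OPEN box with algebraic corners (one rule-(2) move).** A
representation `r` on the open box `∏ᵢ (lᵢ, uᵢ)` (`lᵢ < uᵢ` real algebraic) is congruent modulo
`KZ.relations` to an open-unit-cube representation `t` with integrand
`(∏ᵢ (uᵢ − lᵢ)) · r.integrand (l + (u − l)·x)` (the chart `x ↦ l + (u − l)·x`, constant Jacobian
`∏ᵢ (uᵢ − lᵢ) > 0`). Open-box twin of the landed `StokesGeneration.FibrewiseStokes.stub_boxToCube`. -/
def OpenBoxToCube : Prop :=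
  ∀ (N : ℕ) (l u : Fin N → ℝ) (r : KZ.IntegralRep N), (∀ i, IsAlgebraic ℚ (l i)) →
    (∀ i, IsAlgebraic ℚ (u i)) → (∀ i, l i < u i) →
    r.domain = {x | ∀ i, x i ∈ Set.Ioo (l i) (u i)} →
    ∃ t : KZ.IntegralRep N, t.domain = {x | ∀ i, x i ∈ Set.Ioo (0 : ℝ) 1} ∧
      (∀ x ∈ t.domain,
        t.integrand x = (∏ i, (u i - l i)) * r.integrand (fun i => l i + (u i - l i) * x i)) ∧
      KZ.of r - KZ.of t ∈ KZ.relations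

/-- **Cycling a coordinate of the open unit cube to the last slot is a move** — VERBATIM the
statement of item stmt-KontsevichZagierPeriods-17772 (`CobordismMove.CubeCoordinateCycle`), proved
in `Cruxes/CubeStokes/CubeStokesProof.lean` §2. -/
def CubeCoordinateCycle : Prop :=
  ∀ (d : ℕ) (k : Fin (d + 1)) (R R' : Literature.NumberTheory.Transcendental.KZ.IntegralRep (d + 1)),
    R.domain = {x : Fin (d + 1) → ℝ | ∀ i, x i ∈ Set.Ioo (0 : ℝ) 1} →
    R'.domain = {x : Fin (d + 1) → ℝ | ∀ i, x i ∈ Set.Ioo (0 : ℝ) 1} →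
    Set.EqOn R'.integrand (fun z => R.integrand (Fin.insertNth k (z (Fin.last d)) (Fin.init z)))
      R'.domain →
    Literature.NumberTheory.Transcendental.KZ.of R - Literature.NumberTheory.Transcendental.KZ.of R' ∈
      Literature.NumberTheory.Transcendental.KZ.relations

/-- **Newton–Leibniz along the last coordinate of the open unit cube, bulk term included** —
VERBATIM the statement of item stmt-KontsevichZagierPeriods-17771
(`CobordismMove.CubeLastNewtonLeibniz`), proved in `Cruxes/CubeStokes/CubeStokesProof.lean` §3. -/
def CubeLastNewtonLeibniz : Prop :=
  ∀ (d : ℕ) (A A' : (Fin (d + 1) → ℝ) → ℝ)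
    (R : Literature.NumberTheory.Transcendental.KZ.IntegralRep (d + 1))
    (r₀ r₁ : Literature.NumberTheory.Transcendental.KZ.IntegralRep d),
    Literature.NumberTheory.Transcendental.IsSemialgebraicFunOn ℚ (Set.Icc (0 : Fin (d + 1) → ℝ) 1) A →
    ContinuousOn A (Set.Icc (0 : Fin (d + 1) → ℝ) 1) →
    (∀ y ∈ {y : Fin d → ℝ | ∀ i, y i ∈ Set.Ioo (0 : ℝ) 1}, ∀ t ∈ Set.Ioo (0 : ℝ) 1,
      HasDerivAt (fun s : ℝ => A (Fin.snoc y s)) (A' (Fin.snoc y t)) t) →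
    R.domain = {x : Fin (d + 1) → ℝ | ∀ i, x i ∈ Set.Ioo (0 : ℝ) 1} →
    Set.EqOn R.integrand A' R.domain →
    r₀.domain = {y : Fin d → ℝ | ∀ i, y i ∈ Set.Ioo (0 : ℝ) 1} →
    r₁.domain = {y : Fin d → ℝ | ∀ i, y i ∈ Set.Ioo (0 : ℝ) 1} →
    Set.EqOn r₀.integrand (fun y => A (Fin.snoc y 0)) r₀.domain →
    Set.EqOn r₁.integrand (fun y => A (Fin.snoc y 1)) r₁.domain →
    Literature.NumberTheory.Transcendental.KZ.of R - Literature.NumberTheory.Transcendental.KZ.of r₁ +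
      Literature.NumberTheory.Transcendental.KZ.of r₀ ∈
        Literature.NumberTheory.Transcendental.KZ.relations

/-- `CubeCoordinateCycle` holds: the cube engine, piece stmt-17772 (§0a). [cite: KontsevichZagier2001, §1.2 rule (2)] -/
theorem cubeCoordinateCycle_holds : CubeCoordinateCycle :=
  CubeCoordinateCycle.cubeCoordinateCycle_proof

/-- `CubeLastNewtonLeibniz` holds: the cube engine, piece stmt-17771 (§0b). [cite: KontsevichZagier2001, §1.2 rule (3)] -/
theorem cubeLastNewtonLeibniz_holds : CubeLastNewtonLeibniz :=
  CubeLastNewtonLeibniz.cubeLastNewtonLeibniz_proof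

/-! ### §1 `OpenBoxToCube` (stub 1 of the line) -/

/-- The affine chart maps the open unit cube ONTO the open box `Π (lᵢ, uᵢ)` (`lᵢ < uᵢ`; preimage
point `((yᵢ − lᵢ)/(uᵢ − lᵢ))ᵢ`). [folklore] -/
theorem boxAff_image_openCube {N : ℕ} {l u : Fin N → ℝ} (hlu : ∀ i, l i < u i) :
    (fun y : Fin N → ℝ => fun i => l i + (u i - l i) * y i) ''
        {x : Fin N → ℝ | ∀ i, x i ∈ Set.Ioo (0:ℝ) 1} =
      {x : Fin N → ℝ | ∀ i, x i ∈ Set.Ioo (l i) (u i)} := by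
  ext y
  simp only [mem_image, mem_setOf_eq, mem_Ioo]
  constructor
  · rintro ⟨x, hx, rfl⟩ i
    obtain ⟨h0, h1⟩ := hx i
    have hd : 0 < u i - l i := sub_pos.mpr (hlu i)
    constructor <;> nlinarith
  · intro hy
    refine ⟨fun i => (y i - l i) / (u i - l i), fun i => ?_, ?_⟩
    · have hd : 0 < u i - l i := sub_pos.mpr (hlu i)
      obtain ⟨h0, h1⟩ := hy i
      exact ⟨div_pos (by linarith) hd, (div_lt_one hd).mpr (by linarith)⟩
    · funext i
      have hd : u i - l i ≠ 0 := (sub_pos.mpr (hlu i)).ne'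
      field_simp
      ring

/-- **`OpenBoxToCube`** (stub 1 of line `affine_cube`): affine cubification of an open box with
algebraic corners is one rule-(2) move. [cite: KontsevichZagier2001, §1.2 rule (2)] -/
theorem openBoxToCube_proof : OpenBoxToCube := by
  intro N l u r hl hu hlu hdom
  -- the open unit cube
  have hC : IsSemialgebraic ℚ {x : Fin N → ℝ | ∀ i, x i ∈ Set.Ioo (0:ℝ) 1} :=
    KZ.isSemialgebraic_unitCube N
  have hCmeas : MeasurableSet {x : Fin N → ℝ | ∀ i, x i ∈ Set.Ioo (0:ℝ) 1} :=
    (KZ.isOpen_unitCube N).measurableSet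
  -- the chart: semialgebraic, injective, onto the box, derivative of determinant `Π (uᵢ − lᵢ) > 0`
  have himage := boxAff_image_openCube hlu
  have hdom' : r.domain = (fun y : Fin N → ℝ => fun i => l i + (u i - l i) * y i) ''
      {x : Fin N → ℝ | ∀ i, x i ∈ Set.Ioo (0:ℝ) 1} := hdom.trans himage.symm
  have hmaps : MapsTo (fun y : Fin N → ℝ => fun i => l i + (u i - l i) * y i)
      {x : Fin N → ℝ | ∀ i, x i ∈ Set.Ioo (0:ℝ) 1} r.domain := by
    rw [hdom']
    exact mapsTo_image _ _
  have hsa := boxAff_isSemialgebraicMapOn hC hl hu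
  have hinj : InjOn (fun y : Fin N → ℝ => fun i => l i + (u i - l i) * y i)
      {x : Fin N → ℝ | ∀ i, x i ∈ Set.Ioo (0:ℝ) 1} := (boxAff_injective hlu).injOn
  have hdet : |(LinearMap.toContinuousLinearMap
      (Matrix.toLin' (Matrix.diagonal fun i => u i - l i))).det| = ∏ i, (u i - l i) := by
    rw [boxAff_diag_det]
    exact abs_of_pos (Finset.prod_pos fun i _ => sub_pos.mpr (hlu i))
  -- the cube integrand `(Π (uᵢ − lᵢ)) · (r.integrand ∘ Φ)`: semialgebraic and integrable
  have hcomp : IsSemialgebraicFunOn ℚ {x : Fin N → ℝ | ∀ i, x i ∈ Set.Ioo (0:ℝ) 1}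
      (r.integrand ∘ fun y : Fin N → ℝ => fun i => l i + (u i - l i) * y i) :=
    IsSemialgebraicFunOn.comp_isSemialgebraicMapOn_holds r.isSemialgebraicFunOn_integrand hsa hmaps
  have hg_sa : IsSemialgebraicFunOn ℚ {x : Fin N → ℝ | ∀ i, x i ∈ Set.Ioo (0:ℝ) 1}
      (fun x => (∏ i, (u i - l i)) * r.integrand (fun i => l i + (u i - l i) * x i)) :=
    (isSemialgebraicFunOn_const_of_isAlgebraic hC (boxAff_isAlgebraic_prod hl hu)).fun_mul hcomp
  have hg_int : IntegrableOn
      (fun x => (∏ i, (u i - l i)) * r.integrand (fun i => l i + (u i - l i) * x i))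
      {x : Fin N → ℝ | ∀ i, x i ∈ Set.Ioo (0:ℝ) 1} := by
    have h := (integrableOn_image_iff_integrableOn_abs_det_fderiv_smul volume hCmeas
      (fun x _ => (boxAff_hasFDerivAt l u x).hasFDerivWithinAt) hinj r.integrand).mp
      (hdom' ▸ r.integrableOn)
    refine h.congr_fun (fun x _ => ?_) hCmeas
    simp only [smul_eq_mul, hdet]
  -- the cube representation
  let t : IntegralRep N :=
    ⟨{x : Fin N → ℝ | ∀ i, x i ∈ Set.Ioo (0:ℝ) 1},
      fun x => (∏ i, (u i - l i)) * r.integrand (fun i => l i + (u i - l i) * x i), hC, hg_sa, hg_int⟩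
  refine ⟨t, rfl, fun x _ => rfl, ?_⟩
  -- one change-of-variables move with SOURCE `t` and TARGET `r`
  have hmove : of t - of r ∈ relations := by
    refine changeOfVariablesRel_subset_relations
      ⟨N, t, r, fun y : Fin N → ℝ => fun i => l i + (u i - l i) * y i,
        fun _ => LinearMap.toContinuousLinearMap (Matrix.toLin' (Matrix.diagonal fun i => u i - l i)),
        hsa, fun x _ => (boxAff_hasFDerivAt l u x).hasFDerivWithinAt, hinj, hdom', fun x _ => ?_, rfl⟩
    show (∏ i, (u i - l i)) * r.integrand (fun i => l i + (u i - l i) * x i) =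
      r.integrand (fun i => l i + (u i - l i) * x i) * |(LinearMap.toContinuousLinearMap
        (Matrix.toLin' (Matrix.diagonal fun i => u i - l i))).det|
    rw [hdet, mul_comm]
  rw [← neg_sub]
  exact relations.neg_mem hmove


/-! ### §2 Coordinate cycles on the unit cube; honest face representations -/

variable {d : ℕ}

/-- The coordinate cycle `z ↦ Fin.insertNth k (z last) (Fin.init z)` of `ℝᵈ⁺¹` is a relabelling
of coordinates along an index permutation. [folklore] -/
theorem exists_perm_insertNth (k : Fin (d + 1)) :
    ∃ e : Equiv.Perm (Fin (d + 1)), ∀ z : Fin (d + 1) → ℝ,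
      (fun i => z (e i)) = (Fin.insertNth k (z (Fin.last d)) (Fin.init z) : Fin (d + 1) → ℝ) := by
  refine ⟨(finSuccEquiv' k).trans (finSuccEquiv' (Fin.last d)).symm, fun z => ?_⟩
  funext i
  rcases Fin.eq_self_or_eq_succAbove k i with rfl | ⟨j, rfl⟩
  · simp [finSuccEquiv'_at, finSuccEquiv'_symm_none, Fin.insertNth_apply_same]
  · simp [finSuccEquiv'_succAbove, finSuccEquiv'_symm_some, Fin.insertNth_apply_succAbove,
      Fin.succAbove_last, Fin.init]

/-- The open unit cube is invariant under relabelling coordinates. [folklore] -/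
theorem comp_perm_mem_setOf_iff {N : ℕ} (e : Equiv.Perm (Fin N)) (z : Fin N → ℝ) :
    (fun i => z (e i)) ∈ {x : Fin N → ℝ | ∀ i, x i ∈ Ioo (0 : ℝ) 1} ↔
      z ∈ {x : Fin N → ℝ | ∀ i, x i ∈ Ioo (0 : ℝ) 1} := by
  simp only [mem_setOf_eq]
  exact ⟨fun h i => by simpa using h (e.symm i), fun h i => h (e i)⟩

/-- The closed unit cube is invariant under relabelling coordinates. [folklore] -/
theorem comp_perm_mem_Icc_iff {N : ℕ} (e : Equiv.Perm (Fin N)) (z : Fin N → ℝ) :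
    (fun i => z (e i)) ∈ Icc (0 : Fin N → ℝ) 1 ↔ z ∈ Icc (0 : Fin N → ℝ) 1 := by
  simp only [mem_Icc, Pi.le_def, Pi.zero_apply, Pi.one_apply]
  constructor
  · rintro ⟨h0, h1⟩
    exact ⟨fun i => by simpa using h0 (e.symm i), fun i => by simpa using h1 (e.symm i)⟩
  · rintro ⟨h0, h1⟩
    exact ⟨fun i => h0 (e i), fun i => h1 (e i)⟩

/-- Semialgebraicity on the open unit cube is invariant under relabelling coordinates. [folklore] -/
theorem isSemialgebraicFunOn_comp_perm_setOf {N : ℕ} (e : Equiv.Perm (Fin N))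
    {f : (Fin N → ℝ) → ℝ} (hf : IsSemialgebraicFunOn ℚ {x : Fin N → ℝ | ∀ i, x i ∈ Ioo (0 : ℝ) 1} f) :
    IsSemialgebraicFunOn ℚ {x : Fin N → ℝ | ∀ i, x i ∈ Ioo (0 : ℝ) 1}
      (fun z => f (fun i => z (e i))) := by
  have h := hf.comp_equiv e
  have hset : {w : Fin N → ℝ | (fun i => w (e i)) ∈ {x : Fin N → ℝ | ∀ i, x i ∈ Ioo (0 : ℝ) 1}} =
      {x : Fin N → ℝ | ∀ i, x i ∈ Ioo (0 : ℝ) 1} := by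
    ext w
    exact comp_perm_mem_setOf_iff e w
  rwa [hset] at h

/-- Semialgebraicity on the closed unit cube is invariant under relabelling coordinates. [folklore] -/
theorem isSemialgebraicFunOn_comp_perm_Icc {N : ℕ} (e : Equiv.Perm (Fin N))
    {f : (Fin N → ℝ) → ℝ} (hf : IsSemialgebraicFunOn ℚ (Icc (0 : Fin N → ℝ) 1) f) :
    IsSemialgebraicFunOn ℚ (Icc (0 : Fin N → ℝ) 1) (fun z => f (fun i => z (e i))) := by
  have h := hf.comp_equiv e
  have hset : {w : Fin N → ℝ | (fun i => w (e i)) ∈ Icc (0 : Fin N → ℝ) 1} =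
      Icc (0 : Fin N → ℝ) 1 := by
    ext w
    exact comp_perm_mem_Icc_iff e w
  rwa [hset] at h

/-- Relabelling coordinates is continuous. [folklore] -/
theorem continuous_comp_perm {N : ℕ} (e : Equiv.Perm (Fin N)) :
    Continuous (fun z : Fin N → ℝ => fun i => z (e i)) :=
  continuous_pi fun i => continuous_apply (e i)

/-- Absolute integrability on the open unit cube is invariant under relabelling coordinates (the
relabelling is the volume-preserving `MeasurableEquiv.piCongrLeft` and preserves the cube).
[folklore] -/
theorem integrableOn_comp_perm_setOf {N : ℕ} (e : Equiv.Perm (Fin N)) {f : (Fin N → ℝ) → ℝ}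
    (hf : IntegrableOn f {x : Fin N → ℝ | ∀ i, x i ∈ Ioo (0 : ℝ) 1}) :
    IntegrableOn (fun z => f (fun i => z (e i))) {x : Fin N → ℝ | ∀ i, x i ∈ Ioo (0 : ℝ) 1} := by
  set L : (Fin N → ℝ) ≃ᵐ (Fin N → ℝ) := MeasurableEquiv.piCongrLeft (fun _ : Fin N => ℝ) e.symm
    with hL_def
  have hL : MeasurePreserving L volume volume :=
    volume_measurePreserving_piCongrLeft (fun _ : Fin N => ℝ) e.symm
  have hLapply : ∀ z : Fin N → ℝ, L z = fun i => z (e i) := by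
    intro z
    funext i
    have h := Equiv.piCongrLeft_apply_apply (fun _ : Fin N => ℝ) e.symm z (e i)
    rw [hL_def, MeasurableEquiv.coe_piCongrLeft]
    simpa using h
  have hpre : L ⁻¹' {x : Fin N → ℝ | ∀ i, x i ∈ Ioo (0 : ℝ) 1} =
      {x : Fin N → ℝ | ∀ i, x i ∈ Ioo (0 : ℝ) 1} := by
    ext z
    rw [mem_preimage, hLapply]
    exact comp_perm_mem_setOf_iff e z
  have h := (hL.integrableOn_comp_preimage L.measurableEmbedding (f := f)
    (s := {x : Fin N → ℝ | ∀ i, x i ∈ Ioo (0 : ℝ) 1})).mpr hf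
  rw [hpre] at h
  exact h.congr_fun (fun z _ => by simp only [Function.comp_apply, hLapply])
    (KZ.isOpen_unitCube N).measurableSet

/-- Updating the inserted coordinate. [folklore] -/
theorem update_insertNth (k : Fin (d + 1)) (t s : ℝ) (y : Fin d → ℝ) :
    Function.update (Fin.insertNth k t y : Fin (d + 1) → ℝ) k s = Fin.insertNth k s y := by
  funext i
  rcases Fin.eq_self_or_eq_succAbove k i with rfl | ⟨j, rfl⟩
  · simp [Fin.insertNth_apply_same]
  · rw [Function.update_of_ne (Fin.succAbove_ne k j)]
    simp [Fin.insertNth_apply_succAbove]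

/-- Inserting a coordinate in `(0,1)` into a point of the open `d`-cube gives a point of the open
`(d+1)`-cube. [folklore] -/
theorem insertNth_mem_setOf (k : Fin (d + 1)) {t : ℝ} (ht : t ∈ Ioo (0 : ℝ) 1) {y : Fin d → ℝ}
    (hy : y ∈ {y : Fin d → ℝ | ∀ i, y i ∈ Ioo (0 : ℝ) 1}) :
    (Fin.insertNth k t y : Fin (d + 1) → ℝ) ∈ {x : Fin (d + 1) → ℝ | ∀ i, x i ∈ Ioo (0 : ℝ) 1} := by
  simp only [mem_setOf_eq] at hy ⊢
  intro i
  rcases Fin.eq_self_or_eq_succAbove k i with rfl | ⟨j, rfl⟩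
  · simpa [Fin.insertNth_apply_same] using ht
  · simpa [Fin.insertNth_apply_succAbove] using hy j

/-- Inserting a coordinate in `[0,1]` into a point of the open `d`-cube gives a point of the
closed `(d+1)`-cube. [folklore] -/
theorem insertNth_mem_Icc_of_mem_setOf (k : Fin (d + 1)) {c : ℝ} (hc : c ∈ Icc (0 : ℝ) 1)
    {y : Fin d → ℝ} (hy : y ∈ {y : Fin d → ℝ | ∀ i, y i ∈ Ioo (0 : ℝ) 1}) :
    (Fin.insertNth k c y : Fin (d + 1) → ℝ) ∈ Icc (0 : Fin (d + 1) → ℝ) 1 := by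
  simp only [mem_setOf_eq] at hy
  rw [mem_Icc, Pi.le_def, Pi.le_def]
  constructor
  · intro i
    rcases Fin.eq_self_or_eq_succAbove k i with rfl | ⟨j, rfl⟩
    · simpa [Fin.insertNth_apply_same] using hc.1
    · simpa [Fin.insertNth_apply_succAbove] using (hy j).1.le
  · intro i
    rcases Fin.eq_self_or_eq_succAbove k i with rfl | ⟨j, rfl⟩
    · simpa [Fin.insertNth_apply_same] using hc.2
    · simpa [Fin.insertNth_apply_succAbove] using (hy j).2.le

/-- Inserting a coordinate in `[0,1]` into a point of the closed `d`-cube gives a point of the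
closed `(d+1)`-cube. [folklore] -/
theorem insertNth_mem_Icc_of_mem_Icc (k : Fin (d + 1)) {c : ℝ} (hc : c ∈ Icc (0 : ℝ) 1)
    {y : Fin d → ℝ} (hy : y ∈ Icc (0 : Fin d → ℝ) 1) :
    (Fin.insertNth k c y : Fin (d + 1) → ℝ) ∈ Icc (0 : Fin (d + 1) → ℝ) 1 := by
  rw [mem_Icc, Pi.le_def, Pi.le_def] at hy ⊢
  obtain ⟨h0, h1⟩ := hy
  constructor
  · intro i
    rcases Fin.eq_self_or_eq_succAbove k i with rfl | ⟨j, rfl⟩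
    · simpa [Fin.insertNth_apply_same] using hc.1
    · simpa [Fin.insertNth_apply_succAbove] using h0 j
  · intro i
    rcases Fin.eq_self_or_eq_succAbove k i with rfl | ⟨j, rfl⟩
    · simpa [Fin.insertNth_apply_same] using hc.2
    · simpa [Fin.insertNth_apply_succAbove] using h1 j

/-- The face embedding `y ↦ insertNth k c y` (rational `c`) is a `ℚ`-semialgebraic map on every
`ℚ`-semialgebraic set: its coordinates are the constant `c` and the coordinate functions.
[folklore] -/
theorem isSemialgebraicMapOn_insertNth (k : Fin (d + 1)) (c : ℚ) {σ : Set (Fin d → ℝ)}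
    (hσ : IsSemialgebraic ℚ σ) :
    IsSemialgebraicMapOn ℚ σ (fun y : Fin d → ℝ => (Fin.insertNth k (c : ℝ) y : Fin (d + 1) → ℝ)) := by
  refine IsSemialgebraicMapOn.of_forall hσ fun j => ?_
  rcases Fin.eq_self_or_eq_succAbove k j with rfl | ⟨i, rfl⟩
  · simp only [Fin.insertNth_apply_same]
    exact isSemialgebraicFunOn_ratCast hσ c
  · simp only [Fin.insertNth_apply_succAbove]
    exact isSemialgebraicFunOn_apply hσ i

/-- The face embedding `y ↦ insertNth k c y` is continuous. [folklore] -/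
theorem continuous_insertNth_right (k : Fin (d + 1)) (c : ℝ) :
    Continuous (fun y : Fin d → ℝ => (Fin.insertNth k c y : Fin (d + 1) → ℝ)) := by
  refine continuous_pi fun j => ?_
  rcases Fin.eq_self_or_eq_succAbove k j with rfl | ⟨i, rfl⟩
  · simp only [Fin.insertNth_apply_same]
    exact continuous_const
  · simp only [Fin.insertNth_apply_succAbove]
    exact continuous_apply i

/-- **Honest face representations.** For `B` `ℚ`-semialgebraic and continuous on the closed unit
`(d+1)`-cube and a rational height `c ∈ [0,1]`, the face function `y ↦ B (insertNth k c y)` is the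
integrand of a representation on the open unit `d`-cube (semialgebraic by composition with the
polynomial face embedding; integrable because continuous on the compact closed `d`-cube).
[folklore] -/
theorem exists_faceRep (k : Fin (d + 1)) (c : ℚ) (hc : ((c : ℝ)) ∈ Icc (0 : ℝ) 1)
    {B : (Fin (d + 1) → ℝ) → ℝ} (hB : IsSemialgebraicFunOn ℚ (Icc (0 : Fin (d + 1) → ℝ) 1) B)
    (hBc : ContinuousOn B (Icc (0 : Fin (d + 1) → ℝ) 1)) :
    ∃ r : KZ.IntegralRep d, r.domain = {y : Fin d → ℝ | ∀ i, y i ∈ Ioo (0 : ℝ) 1} ∧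
      r.integrand = fun y => B (Fin.insertNth k (c : ℝ) y) := by
  have hUd : IsSemialgebraic ℚ {y : Fin d → ℝ | ∀ i, y i ∈ Ioo (0 : ℝ) 1} :=
    KZ.isSemialgebraic_unitCube d
  have hsa : IsSemialgebraicFunOn ℚ {y : Fin d → ℝ | ∀ i, y i ∈ Ioo (0 : ℝ) 1}
      (fun y => B (Fin.insertNth k (c : ℝ) y)) :=
    (IsSemialgebraicFunOn.comp_isSemialgebraicMapOn_holds hB (isSemialgebraicMapOn_insertNth k c hUd)
      fun y hy => insertNth_mem_Icc_of_mem_setOf k hc hy).congr fun _ _ => rfl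
  have hcont : ContinuousOn (fun y => B (Fin.insertNth k (c : ℝ) y)) (Icc (0 : Fin d → ℝ) 1) :=
    hBc.comp (continuous_insertNth_right k c).continuousOn
      fun y hy => insertNth_mem_Icc_of_mem_Icc k hc hy
  have hint : IntegrableOn (fun y => B (Fin.insertNth k (c : ℝ) y))
      {y : Fin d → ℝ | ∀ i, y i ∈ Ioo (0 : ℝ) 1} :=
    (hcont.integrableOn_compact isCompact_Icc).mono_set (KZ.unitCube_subset_Icc d)
  exact ⟨⟨_, _, hUd, hsa, hint⟩, rfl, rfl⟩

/-! ### §3 Descent along one coordinate on the unit cube -/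

/-- **Descent along one coordinate `k` on the open unit cube** from stubs 2 and 3: an integrand
`B'` which is `∂B/∂x_k` for a potential `B` semialgebraic and continuous on the closed cube descends
to the face representation `[(0,1)ⁿ, B(x_k = 1) − B(x_k = 0)]`. The potential and its derivative are
transported through the coordinate cycle `z ↦ insertNth k (z last) (init z)`; stub 2 moves the bulk,
stub 3 descends the cycled bulk to the two honest faces (`exists_faceRep`), rule (1b) recombines
them into the given face representation. [cite: KontsevichZagier2001, §1.2] -/
theorem cubeSingleCoordinateDescent (h₂ : CubeCoordinateCycle) (h₃ : CubeLastNewtonLeibniz)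
    (n : ℕ) (k : Fin (n + 1)) (B B' : (Fin (n + 1) → ℝ) → ℝ) (R : KZ.IntegralRep (n + 1))
    (s : KZ.IntegralRep n)
    (hRd : R.domain = {x : Fin (n + 1) → ℝ | ∀ i, x i ∈ Ioo (0 : ℝ) 1})
    (hB : IsSemialgebraicFunOn ℚ (Icc (0 : Fin (n + 1) → ℝ) 1) B)
    (hBc : ContinuousOn B (Icc (0 : Fin (n + 1) → ℝ) 1))
    (hder : ∀ z ∈ R.domain, HasDerivAt (fun t : ℝ => B (Function.update z k t)) (B' z) (z k))
    (hRi : EqOn R.integrand B' R.domain)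
    (hsd : s.domain = {y : Fin n → ℝ | ∀ i, y i ∈ Ioo (0 : ℝ) 1})
    (hsi : EqOn s.integrand (fun y => B (Fin.insertNth k 1 y) - B (Fin.insertNth k 0 y)) s.domain) :
    KZ.of R - KZ.of s ∈ KZ.relations := by
  obtain ⟨e, he⟩ := exists_perm_insertNth (d := n) k
  have hU : IsSemialgebraic ℚ {x : Fin (n + 1) → ℝ | ∀ i, x i ∈ Ioo (0 : ℝ) 1} :=
    KZ.isSemialgebraic_unitCube (n + 1)
  -- (a) the derivative on the open cube
  have hB'sa : IsSemialgebraicFunOn ℚ {x : Fin (n + 1) → ℝ | ∀ i, x i ∈ Ioo (0 : ℝ) 1} B' := by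
    have h := R.isSemialgebraicFunOn_integrand.congr hRi
    rwa [hRd] at h
  have hB'int : IntegrableOn B' {x : Fin (n + 1) → ℝ | ∀ i, x i ∈ Ioo (0 : ℝ) 1} := by
    have h := R.integrableOn.congr_fun hRi (KZ.IntegralRep.measurableSet_domain_holds R)
    rwa [hRd] at h
  -- (b) transport through the coordinate cycle
  have hCsa : IsSemialgebraicFunOn ℚ (Icc (0 : Fin (n + 1) → ℝ) 1)
      (fun z => B (Fin.insertNth k (z (Fin.last n)) (Fin.init z))) :=
    (isSemialgebraicFunOn_comp_perm_Icc e hB).congr fun z _ => congrArg B (he z)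
  have hC'sa : IsSemialgebraicFunOn ℚ {x : Fin (n + 1) → ℝ | ∀ i, x i ∈ Ioo (0 : ℝ) 1}
      (fun z => B' (Fin.insertNth k (z (Fin.last n)) (Fin.init z))) :=
    (isSemialgebraicFunOn_comp_perm_setOf e hB'sa).congr fun z _ => congrArg B' (he z)
  have hC'int : IntegrableOn (fun z => B' (Fin.insertNth k (z (Fin.last n)) (Fin.init z)))
      {x : Fin (n + 1) → ℝ | ∀ i, x i ∈ Ioo (0 : ℝ) 1} :=
    (integrableOn_comp_perm_setOf e hB'int).congr_fun (fun z _ => congrArg B' (he z))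
      (KZ.isOpen_unitCube (n + 1)).measurableSet
  have hCcont : ContinuousOn (fun z => B (Fin.insertNth k (z (Fin.last n)) (Fin.init z)))
      (Icc (0 : Fin (n + 1) → ℝ) 1) := by
    have h : ContinuousOn (fun z : Fin (n + 1) → ℝ => B (fun i => z (e i)))
        (Icc (0 : Fin (n + 1) → ℝ) 1) :=
      hBc.comp (continuous_comp_perm e).continuousOn fun z hz => (comp_perm_mem_Icc_iff e z).2 hz
    exact h.congr fun z _ => (congrArg B (he z)).symm
  have hCder : ∀ y ∈ {y : Fin n → ℝ | ∀ i, y i ∈ Ioo (0 : ℝ) 1}, ∀ t ∈ Ioo (0 : ℝ) 1,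
      HasDerivAt
        (fun σ : ℝ => B (Fin.insertNth k ((Fin.snoc y σ : Fin (n + 1) → ℝ) (Fin.last n))
          (Fin.init (Fin.snoc y σ : Fin (n + 1) → ℝ))))
        (B' (Fin.insertNth k ((Fin.snoc y t : Fin (n + 1) → ℝ) (Fin.last n))
          (Fin.init (Fin.snoc y t : Fin (n + 1) → ℝ)))) t := by
    intro y hy t ht
    simp only [Fin.snoc_last, Fin.init_snoc]
    have hx : (Fin.insertNth k t y : Fin (n + 1) → ℝ) ∈ R.domain := by
      rw [hRd]
      exact insertNth_mem_setOf k ht hy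
    have h := hder _ hx
    simp only [Fin.insertNth_apply_same, update_insertNth] at h
    exact h
  -- (c) the cycled bulk representation and stub 2
  let Rt : KZ.IntegralRep (n + 1) :=
    { domain := {x | ∀ i, x i ∈ Ioo (0 : ℝ) 1}
      integrand := fun z => B' (Fin.insertNth k (z (Fin.last n)) (Fin.init z))
      isSemialgebraic_domain := hU
      isSemialgebraicFunOn_integrand := hC'sa
      integrableOn := hC'int }
  have hcyc : KZ.of R - KZ.of Rt ∈ KZ.relations := by
    refine h₂ n k R Rt hRd rfl fun z hz => ?_
    have hmem : (Fin.insertNth k (z (Fin.last n)) (Fin.init z) : Fin (n + 1) → ℝ) ∈ R.domain := by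
      rw [hRd, ← he z]
      exact (comp_perm_mem_setOf_iff e z).2 hz
    exact (hRi hmem).symm
  -- (d) the two honest faces and stub 3
  obtain ⟨r₀, hr₀d, hr₀i⟩ := exists_faceRep (d := n) k 0 (by norm_num) hB hBc
  obtain ⟨r₁, hr₁d, hr₁i⟩ := exists_faceRep (d := n) k 1 (by norm_num) hB hBc
  have hNL : KZ.of Rt - KZ.of r₁ + KZ.of r₀ ∈ KZ.relations := by
    refine h₃ n (fun z => B (Fin.insertNth k (z (Fin.last n)) (Fin.init z)))
      (fun z => B' (Fin.insertNth k (z (Fin.last n)) (Fin.init z))) Rt r₀ r₁ hCsa hCcont hCder rfl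
      (fun _ _ => rfl) hr₀d hr₁d ?_ ?_
    · intro y _
      rw [hr₀i]
      simp
    · intro y _
      rw [hr₁i]
      simp
  -- (e) recombine the two faces into the given face representation
  have hsplit : KZ.of s - KZ.of r₁ - KZ.of r₀.neg ∈ KZ.relations := by
    refine KZ.integrandAddRel_subset_relations ⟨n, s, r₁, r₀.neg, by rw [hr₁d, hsd],
      by rw [KZ.IntegralRep.domain_neg, hr₀d, hsd], fun y hy => ?_, rfl⟩
    rw [hsi hy, Pi.add_apply, KZ.IntegralRep.integrand_neg, Pi.neg_apply, hr₁i, hr₀i]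
    simp only [Rat.cast_one, Rat.cast_zero]
    ring
  have hneg : KZ.of r₀.neg + KZ.of r₀ ∈ KZ.relations := by
    have h := KZ.of_add_of_mem_relations_of_eqOn_neg (r := r₀) (r' := r₀.neg)
      (KZ.IntegralRep.domain_neg r₀) (fun x _ => by rw [KZ.IntegralRep.integrand_neg])
    rwa [add_comm] at h
  have key : KZ.of R - KZ.of s = (KZ.of R - KZ.of Rt) + (KZ.of Rt - KZ.of r₁ + KZ.of r₀) -
      (KZ.of s - KZ.of r₁ - KZ.of r₀.neg) - (KZ.of r₀.neg + KZ.of r₀) := by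
    abel
  rw [key]
  exact KZ.relations.sub_mem (KZ.relations.sub_mem (KZ.relations.add_mem hcyc hNL) hsplit) hneg

/-! ### §4 The diagonal affine chart `x ↦ a + (b − a)·x` -/

/-- The affine chart commutes with updating a coordinate. [folklore] -/
theorem boxAff_update (a b : Fin (d + 1) → ℝ) (x : Fin (d + 1) → ℝ) (k : Fin (d + 1)) (t : ℝ) :
    (fun i => a i + (b i - a i) * Function.update x k t i) =
      Function.update (fun i => a i + (b i - a i) * x i) k (a k + (b k - a k) * t) := by
  funext i
  by_cases hik : i = k
  · subst hik
    simp
  · simp [Function.update_of_ne hik]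

/-- The affine chart commutes with inserting a coordinate: `Φ (insertNth k c y) =
insertNth k (a_k + (b_k − a_k) c) (Φ_k y)`, `Φ_k` the chart of the `k`-th face. [folklore] -/
theorem boxAff_insertNth (a b : Fin (d + 1) → ℝ) (k : Fin (d + 1)) (c : ℝ) (y : Fin d → ℝ) :
    (fun i => a i + (b i - a i) * (Fin.insertNth k c y : Fin (d + 1) → ℝ) i) =
      (Fin.insertNth k (a k + (b k - a k) * c)
        (fun j => a (k.succAbove j) + (b (k.succAbove j) - a (k.succAbove j)) * y j) :
          Fin (d + 1) → ℝ) := by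
  funext i
  rcases Fin.eq_self_or_eq_succAbove k i with rfl | ⟨j, rfl⟩
  · simp [Fin.insertNth_apply_same]
  · simp [Fin.insertNth_apply_succAbove]

/-- The affine chart maps the open unit cube into the open box. [folklore] -/
theorem boxAff_mem_openBox {N : ℕ} {a b : Fin N → ℝ} (hab : ∀ i, a i < b i) {x : Fin N → ℝ}
    (hx : x ∈ {x : Fin N → ℝ | ∀ i, x i ∈ Ioo (0 : ℝ) 1}) :
    (fun i => a i + (b i - a i) * x i) ∈ {z : Fin N → ℝ | ∀ i, z i ∈ Ioo (a i) (b i)} := by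
  intro i
  have h0 := (hx i).1
  have h1 := (hx i).2
  have hd := sub_pos.2 (hab i)
  constructor <;> nlinarith

/-- The affine chart maps the closed unit cube into the closed box. [folklore] -/
theorem boxAff_mem_closedBox {N : ℕ} {a b : Fin N → ℝ} (hab : ∀ i, a i < b i) {x : Fin N → ℝ}
    (hx : x ∈ Icc (0 : Fin N → ℝ) 1) :
    (fun i => a i + (b i - a i) * x i) ∈ {z : Fin N → ℝ | ∀ j, z j ∈ Icc (a j) (b j)} := by
  rw [mem_Icc, Pi.le_def, Pi.le_def] at hx
  intro i
  have h0 := hx.1 i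
  have h1 := hx.2 i
  simp only [Pi.zero_apply, Pi.one_apply] at h0 h1
  have hd := sub_pos.2 (hab i)
  constructor <;> nlinarith

/-- The affine chart is continuous. [folklore] -/
theorem continuous_boxAff {N : ℕ} (a b : Fin N → ℝ) :
    Continuous (fun x : Fin N → ℝ => fun i => a i + (b i - a i) * x i) :=
  continuous_pi fun i => continuous_const.add (continuous_const.mul (continuous_apply i))

/-! ### §5 Descent along one coordinate on a box -/

/-- **Descent along one coordinate `k` on an open box** from the three stubs: on
`∏ (aᵢ, bᵢ)`, an integrand `A'` which is `∂A/∂z_k` for a potential `A` semialgebraic and continuous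
on the closed box descends to the face representation `[open face box, A(z_k = b_k) − A(z_k = a_k)]`.
Stub 1 moves the bulk to the unit cube (Jacobian `J = ∏ (bᵢ − aᵢ)`) and the face to the unit
`n`-cube (Jacobian `J_k = ∏_{j ≠ k} (b_j − a_j)`); the cube potential `J_k · (A ∘ Φ)` has
`k`-derivative `J · (A' ∘ Φ)` (one-variable chain rule, `J = (b_k − a_k) J_k`) and faces
`J_k · A(z_k = b_k) ∘ Φ_k`, `J_k · A(z_k = a_k) ∘ Φ_k`; `cubeSingleCoordinateDescent` does the rest.
[cite: KontsevichZagier2001, §1.2] -/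
theorem boxSingleCoordinateDescent (h₁ : OpenBoxToCube) (h₂ : CubeCoordinateCycle)
    (h₃ : CubeLastNewtonLeibniz)
    (n : ℕ) (k : Fin (n + 1)) (a b : Fin (n + 1) → ℝ) (A A' : (Fin (n + 1) → ℝ) → ℝ)
    (R : KZ.IntegralRep (n + 1)) (s : KZ.IntegralRep n)
    (hab : ∀ i, a i < b i)
    (hRd : R.domain = {z | ∀ i, z i ∈ Set.Ioo (a i) (b i)})
    (hA : IsSemialgebraicFunOn ℚ {z | ∀ j, z j ∈ Set.Icc (a j) (b j)} A)
    (hAc : ContinuousOn A {z | ∀ j, z j ∈ Set.Icc (a j) (b j)})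
    (hder : ∀ z ∈ R.domain, HasDerivAt (fun t : ℝ => A (Function.update z k t)) (A' z) (z k))
    (hRi : Set.EqOn R.integrand A' R.domain)
    (hsd : s.domain = {y | ∀ j, y j ∈ Set.Ioo (a (Fin.succAbove k j)) (b (Fin.succAbove k j))})
    (hsi : Set.EqOn s.integrand (fun y => A (Fin.insertNth k (b k) y) - A (Fin.insertNth k (a k) y))
      s.domain) :
    KZ.of R - KZ.of s ∈ KZ.relations := by
  -- the corners are algebraic
  have halg : ∀ i, IsAlgebraic ℚ (a i) ∧ IsAlgebraic ℚ (b i) :=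
    isAlgebraic_corner_of_isSemialgebraic_openBox hab (hRd ▸ R.isSemialgebraic_domain)
  have habk : ∀ j : Fin n, a (k.succAbove j) < b (k.succAbove j) := fun j => hab _
  -- (i) stub 1 on the bulk and on the face
  obtain ⟨T, hTd, hTi, hRT⟩ :=
    h₁ (n + 1) a b R (fun i => (halg i).1) (fun i => (halg i).2) hab hRd
  obtain ⟨T', hT'd, hT'i, hsT'⟩ :=
    h₁ n (fun j => a (k.succAbove j)) (fun j => b (k.succAbove j)) s (fun j => (halg _).1)
      (fun j => (halg _).2) habk hsd
  -- Jacobians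
  set J : ℝ := ∏ i, (b i - a i) with hJ
  set Jk : ℝ := ∏ j : Fin n, (b (k.succAbove j) - a (k.succAbove j)) with hJk
  have hJJk : J = (b k - a k) * Jk := by
    rw [hJ, Fin.prod_univ_succAbove _ k]
  have hJk_alg : IsAlgebraic ℚ Jk :=
    boxAff_isAlgebraic_prod (fun j => (halg (k.succAbove j)).1) fun j => (halg (k.succAbove j)).2
  -- (ii) the cube potential `B = J_k · (A ∘ Φ)` and its data
  have hCube : IsSemialgebraic ℚ (Icc (0 : Fin (n + 1) → ℝ) 1) := by
    rw [← KZ.cube_eq_Icc]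
    exact KZ.isSemialgebraic_cube
  have hΦsa : IsSemialgebraicMapOn ℚ (Icc (0 : Fin (n + 1) → ℝ) 1)
      (fun x : Fin (n + 1) → ℝ => fun i => a i + (b i - a i) * x i) :=
    boxAff_isSemialgebraicMapOn hCube (fun i => (halg i).1) fun i => (halg i).2
  have hB : IsSemialgebraicFunOn ℚ (Icc (0 : Fin (n + 1) → ℝ) 1)
      (fun x => Jk * A (fun i => a i + (b i - a i) * x i)) :=
    (isSemialgebraicFunOn_const_of_isAlgebraic hCube hJk_alg).fun_mul
      ((IsSemialgebraicFunOn.comp_isSemialgebraicMapOn_holds hA hΦsa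
        fun x hx => boxAff_mem_closedBox hab hx).congr fun _ _ => rfl)
  have hBc : ContinuousOn (fun x => Jk * A (fun i => a i + (b i - a i) * x i))
      (Icc (0 : Fin (n + 1) → ℝ) 1) :=
    continuousOn_const.mul
      (hAc.comp (continuous_boxAff a b).continuousOn fun x hx => boxAff_mem_closedBox hab hx)
  have hder' : ∀ x ∈ T.domain,
      HasDerivAt (fun t : ℝ => Jk * A (fun i => a i + (b i - a i) * Function.update x k t i))
        (J * A' (fun i => a i + (b i - a i) * x i)) (x k) := by
    intro x hx
    rw [hTd] at hx
    have hΦx : (fun i => a i + (b i - a i) * x i) ∈ R.domain := by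
      rw [hRd]
      exact boxAff_mem_openBox hab hx
    have hg := hder _ hΦx
    have hh : HasDerivAt (fun t : ℝ => a k + (b k - a k) * t) (b k - a k) (x k) := by
      simpa using ((hasDerivAt_id (x k)).const_mul (b k - a k)).const_add (a k)
    have hcomp := hg.comp (x k) hh
    have hfun : (fun t : ℝ => Jk * A (fun i => a i + (b i - a i) * Function.update x k t i)) =
        fun t => Jk * ((fun t => A (Function.update (fun i => a i + (b i - a i) * x i) k t)) ∘
          (fun t => a k + (b k - a k) * t)) t := by
      funext t
      simp only [Function.comp_apply, boxAff_update]
    rw [hfun]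
    refine (hcomp.const_mul Jk).congr_deriv ?_
    rw [hJJk]
    ring
  have hTi' : EqOn T.integrand (fun x => J * A' (fun i => a i + (b i - a i) * x i)) T.domain := by
    intro x hx
    have hΦx : (fun i => a i + (b i - a i) * x i) ∈ R.domain := by
      rw [hRd]
      exact boxAff_mem_openBox hab (hTd ▸ hx)
    rw [hTi x hx, hRi hΦx]
  have hT'i' : EqOn T'.integrand
      (fun y => Jk * A (fun i => a i + (b i - a i) * (Fin.insertNth k 1 y : Fin (n + 1) → ℝ) i) -
        Jk * A (fun i => a i + (b i - a i) * (Fin.insertNth k 0 y : Fin (n + 1) → ℝ) i)) T'.domain := by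
    intro y hy
    have hΦy : (fun j => a (k.succAbove j) + (b (k.succAbove j) - a (k.succAbove j)) * y j) ∈
        s.domain := by
      rw [hsd]
      exact boxAff_mem_openBox habk (hT'd ▸ hy)
    have h1 : a k + (b k - a k) * 1 = b k := by ring
    have h0 : a k + (b k - a k) * 0 = a k := by ring
    simp only [boxAff_insertNth, h1, h0]
    rw [hT'i y hy, hsi hΦy]
    ring
  -- (iii) the cube engine between the two cubified representations
  have hmid : KZ.of T - KZ.of T' ∈ KZ.relations :=
    cubeSingleCoordinateDescent h₂ h₃ n k (fun x => Jk * A (fun i => a i + (b i - a i) * x i))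
      (fun x => J * A' (fun i => a i + (b i - a i) * x i)) T T' hTd hB hBc hder' hTi' hT'd hT'i'
  have key : KZ.of R - KZ.of s = (KZ.of R - KZ.of T) + (KZ.of T - KZ.of T') - (KZ.of s - KZ.of T') := by
    abel
  rw [key]
  exact KZ.relations.sub_mem (KZ.relations.add_mem hRT hmid) hsT'

end Summit.KontsevichZagierPeriods.GenericPointClass.ExactDescentBox

/-! ### §6 The assembly -/

namespace Summit.KontsevichZagierPeriods.GenericPointClass

open Summit.KontsevichZagierPeriods.GenericPointClass.ExactDescentBox

/-- **Settles stmt-KontsevichZagierPeriods-4427 (`ExactDescentBox`, Theorem B on boxes).** Split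
`[box, ∑ᵢ ∂ᵢAᵢ]` into the pieces `[box, ∂ᵢAᵢ]` (iterated rule (1b), the tree theorem
`KZ.of_sub_sum_integrand_mem_relations`), descend each piece along its own coordinate
(`boxSingleCoordinateDescent` fed with the three proved pieces `openBoxToCube_proof` (§1) and the cube
engine `cubeCoordinateCycle_holds` / `cubeLastNewtonLeibniz_holds` (§0, items stmt-17772 / stmt-17771 of
route CobordismMove)), and add up in `KZ.relations`. [cite: KontsevichZagier2001, §1.2] -/
theorem exactDescentBox_proof :
    Summit.KontsevichZagierPeriods.KontsevichZagierPeriods.Theses.GenericPointClass.ExactDescentBox := by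
  intro n a b r A A' s hab hdom hA hAc hder hA' hint hsum hsd hsi
  -- the per-coordinate pieces `[box, ∂ᵢ Aᵢ]`
  let R : Fin (n + 1) → KZ.IntegralRep (n + 1) := fun i =>
    { domain := r.domain
      integrand := A' i
      isSemialgebraic_domain := r.isSemialgebraic_domain
      isSemialgebraicFunOn_integrand := hA' i
      integrableOn := hint i }
  have hsplit : KZ.of r - ∑ i, KZ.of (R i) ∈ KZ.relations :=
    KZ.of_sub_sum_integrand_mem_relations Finset.univ R r (fun _ _ => rfl)
      (fun z hz => by simpa [R] using hsum hz)
  have hdesc : ∀ i, KZ.of (R i) - KZ.of (s i) ∈ KZ.relations := fun i =>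
    boxSingleCoordinateDescent openBoxToCube_proof cubeCoordinateCycle_holds cubeLastNewtonLeibniz_holds
      n i a b (A i) (A' i) (R i) (s i) hab hdom (hA i) (hAc i) (hder i) (fun _ _ => rfl) (hsd i) (hsi i)
  have heq : KZ.of r - ∑ i, KZ.of (s i) =
      (KZ.of r - ∑ i, KZ.of (R i)) + ∑ i, (KZ.of (R i) - KZ.of (s i)) := by
    rw [Finset.sum_sub_distrib]
    abel
  rw [heq]
  exact KZ.relations.add_mem hsplit (sum_mem fun i _ => hdesc i)

end Summit.KontsevichZagierPeriods.GenericPointClass
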